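import Mathlib
import HarnessLib

/-!
# K6 crux `MuTransferX9` (stmt-BirchSwinnertonDyer-19276), conditional surface F2
# (`Kato2004.mem_pSmul_of_red_eq_zero`, aside 19844), input (c) of «Lemma 8.5 (2) on the pin»:
# a DETERMINISTIC `p^k`-PERIODIC sequence in a finite set of `p`-torsion elements of size `< p^k`
# has a `p`-POWER period `< p^k`, hence its sum over `p^k` consecutive terms VANISHES

Cell `bsd-smallim`, seat `bsd-smallim-k6-g3` (gen 2).  THEOREMS ONLY (no definition, no named fact,
no `sorry`); pure algebra (no Galois theory, no curve).  HONEST FRAMING: helper toward crux 19276 (its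
conditional surface F2 via the aside item 19844 `KatoReductionModPKernel`); closes nothing.  PARTITION
(D-0054): X9 (A4) × p ∈ {5,7} (+ X10b∧¬Surj at 3) — helper; closes NONE.  Consumer: lur-a g2's step
(b1) of `UniversalNorms.mem_integralH1_of_layerCores_eq_of_smul_mem` (STATUS l.379): with
representatives `φ'^i` (`i < p^k`) of `Γ_{n'}/Γ_m`, `res_I z_{n'} = Σ_{i<p^k} res_I(φ'^i · z_m)`, and the
summands `s_i` form a DETERMINISTIC (`s_i = s_j ⟹ s_{i+1} = s_{j+1}`, by `res (φ'·y) = 0 ⟸ res y = 0`)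
`p^k`-PERIODIC (`φ'^{p^k} ∈ Γ_m`) sequence in the `p`-torsion of `H¹(Γ_m ⊓ I_𝔓, T_pW)`, a set of size
`≤ p²` (k6-g3 `…X9TateH1TorsionCard`, k6-g4 `Kato2004.finite_setOf_prime_smul_eq_zero`).  The referee's
advance flag (v23, STATUS l.381: «(b1) pigeonhole must force a p-POWER period, not arbitrary d») is
exactly what this file proves: the MINIMAL period divides `p^k`, so it is a power of `p`.

## What (all for `s : ℕ → B`, `B` an additive commutative monoid)

* `apply_add_eq_of_apply_eq` — determinism propagates: `s i = s j ⟹ s (i + t) = s (j + t)`.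
* `apply_add_mul_eq_of_periodic` — a period `P` gives periods `P·n`.
* `sum_range_mul_eq_smul_sum_of_periodic` — for a `P`-periodic `s`, `Σ_{i<n·P} s i = n • Σ_{i<P} s i`.
* `exists_period_le_card` — a deterministic sequence with values in a finite set `A` which is purely
  periodic (some period `Q > 0`) has a period `d` with `0 < d ≤ #A` (pigeonhole on `s 0, …, s #A`, then
  transport of the eventual period to all indices through the pure period `Q`).
* `find_period_dvd` — the least period divides every period.
* **`sum_range_prime_pow_eq_zero_of_periodic`** — if `s` is deterministic, `p^k`-periodic, with values in
  a finite set `A` of elements killed by `p` and `#A < p^k`, then `Σ_{i<p^k} s i = 0`: the least period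
  `d₀ ≤ #A < p^k` divides `p^k`, so `d₀ = p^j` with `j < k`, `s` is `p^{k−1}`-periodic, and
  `Σ_{i<p^k} s i = p • Σ_{i<p^{k−1}} s i = 0`.
* `sum_range_prime_pow_eq_zero_of_periodic_of_le_sq` — the consumer's instance `#A ≤ p²`, `3 ≤ k`.

References: K. Kato, Astérisque 295 (2004) Lemma 8.5 (2) (p. 183) [Kato2004Asterisque] (the statement
this serves: universal norms along the cyclotomic tower are unramified away from `p`); K. Rubin, *Euler
Systems* (2000) App. B Prop. B.3.3 [Rubin2000]; J. Neukirch, A. Schmidt, K. Wingberg, *Cohomology of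
Number Fields* (2008) I §5 (cor ∘ res as a norm) [NeukirchSchmidtWingberg2008].
-/

-- the summit and its single problem are both named `BirchSwinnertonDyer` (registry layout D-0017)
set_option linter.dupNamespace false
set_option autoImplicit false

open Finset

namespace Summit.BirchSwinnertonDyer.BirchSwinnertonDyer.Rank1Residual.UniversalNorms

section Periodic

variable {B : Type*} (s : ℕ → B)

/-- **Determinism propagates.**  If equal terms have equal successors, then equal terms have equal
translates: `s i = s j ⟹ s (i + t) = s (j + t)`. [folklore] -/
theorem apply_add_eq_of_apply_eq (hdet : ∀ i j, s i = s j → s (i + 1) = s (j + 1)) {i j : ℕ}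
    (h : s i = s j) (t : ℕ) : s (i + t) = s (j + t) := by
  induction t with
  | zero => simpa using h
  | succ t ih =>
    have := hdet _ _ ih
    simpa [Nat.add_assoc] using this

/-- A period `P` gives the periods `P·n`: `s (i + P·n) = s i`. [folklore] -/
theorem apply_add_mul_eq_of_periodic {P : ℕ} (hP : ∀ i, s (i + P) = s i) (i n : ℕ) :
    s (i + P * n) = s i := by
  induction n with
  | zero => simp
  | succ n ih => rw [Nat.mul_succ, ← Nat.add_assoc, hP, ih]

variable [AddCommMonoid B]

/-- **Sum over a multiple of a period**: for a `P`-periodic `s`, `Σ_{i<n·P} s i = n • Σ_{i<P} s i`.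
[folklore] -/
theorem sum_range_mul_eq_smul_sum_of_periodic {P : ℕ} (hP : ∀ i, s (i + P) = s i) (n : ℕ) :
    ∑ i ∈ range (n * P), s i = n • ∑ i ∈ range P, s i := by
  induction n with
  | zero => simp
  | succ n ih =>
    rw [Nat.succ_mul, sum_range_add, ih, succ_nsmul]
    congr 1
    refine sum_congr rfl fun i _ => ?_
    rw [Nat.add_comm, Nat.mul_comm, apply_add_mul_eq_of_periodic s hP]

omit [AddCommMonoid B] in
/-- **Pigeonhole: a purely periodic deterministic sequence in a finite set `A` has a period `≤ #A`.**
Among `s 0, …, s #A` two terms coincide, `s i = s j` with `i < j ≤ #A`; determinism gives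
`s (i + t) = s (j + t)` for all `t`, and a pure period `Q > 0` transports this to every index:
`s (t + (j − i)) = s t`. [folklore] -/
theorem exists_period_le_card (hdet : ∀ i j, s i = s j → s (i + 1) = s (j + 1))
    (A : Set B) (hA : A.Finite) (hmem : ∀ i, s i ∈ A) {Q : ℕ} (hQ : 0 < Q)
    (hper : ∀ i, s (i + Q) = s i) :
    ∃ d : ℕ, 0 < d ∧ d ≤ Nat.card A ∧ ∀ t, s (t + d) = s t := by
  classical
  -- two equal terms among the first `#A + 1`
  have hlt : hA.toFinset.card < (range (Nat.card A + 1)).card := by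
    rw [card_range, Nat.card_coe_set_eq, Set.ncard_eq_toFinset_card A hA]
    exact Nat.lt_succ_self _
  have hmaps : Set.MapsTo s (range (Nat.card A + 1) : Finset ℕ) hA.toFinset := fun i _ => by
    rw [Finset.mem_coe, Set.Finite.mem_toFinset]
    exact hmem i
  obtain ⟨x, hx, y, hy, hxy, hsxy⟩ := exists_ne_map_eq_of_card_lt_of_maps_to hlt hmaps
  rw [mem_range] at hx hy
  -- order them: `i < j ≤ #A`, `s i = s j`
  obtain ⟨i, j, hij, hj, hsij⟩ : ∃ i j : ℕ, i < j ∧ j ≤ Nat.card A ∧ s i = s j := by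
    rcases lt_or_gt_of_ne hxy with h | h
    · exact ⟨x, y, h, by omega, hsxy⟩
    · exact ⟨y, x, h, by omega, hsxy.symm⟩
  refine ⟨j - i, by omega, by omega, fun t => ?_⟩
  -- transport along the pure period `Q`: shift by `Q * i ≥ i`
  have hQi : i ≤ Q * i := Nat.le_mul_of_pos_left i hQ
  have h1 : s (t + (j - i)) = s (t + (j - i) + Q * i) := (apply_add_mul_eq_of_periodic s hper _ i).symm
  have h2 : s t = s (t + Q * i) := (apply_add_mul_eq_of_periodic s hper t i).symm
  have h3 : s (i + (t + (Q * i - i))) = s (j + (t + (Q * i - i))) := apply_add_eq_of_apply_eq s hdet hsij _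
  have e1 : t + (j - i) + Q * i = j + (t + (Q * i - i)) := by omega
  have e2 : t + Q * i = i + (t + (Q * i - i)) := by omega
  rw [h1, h2, e1, e2, h3]

omit [AddCommMonoid B] in
/-- **The least period divides every period** (Euclid: the remainder of a period modulo the least period
is again a period). [folklore] -/
theorem find_period_dvd (h : ∃ d : ℕ, 0 < d ∧ ∀ t, s (t + d) = s t) [DecidablePred fun d : ℕ => 0 < d ∧ ∀ t, s (t + d) = s t]
    {P : ℕ} (hP : ∀ t, s (t + P) = s t) : Nat.find h ∣ P := by
  set d₀ := Nat.find h with hd₀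
  obtain ⟨hd₀pos, hd₀per⟩ : 0 < d₀ ∧ ∀ t, s (t + d₀) = s t := Nat.find_spec h
  -- the remainder `P % d₀` is a period
  have hr : ∀ t, s (t + P % d₀) = s t := fun t => by
    have h1 := apply_add_mul_eq_of_periodic s hd₀per (t + P % d₀) (P / d₀)
    rw [Nat.add_assoc, Nat.mod_add_div] at h1
    rw [← h1, hP]
  -- so it vanishes, by minimality
  by_contra hnd
  have hrpos : 0 < P % d₀ := Nat.pos_of_ne_zero fun h0 => hnd (Nat.dvd_of_mod_eq_zero h0)
  have hmin := Nat.find_min h (Nat.mod_lt P hd₀pos)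
  exact hmin ⟨hrpos, hr⟩

/-- **The sum over a `p`-power period of a deterministic periodic sequence of `p`-torsion elements in a
small finite set vanishes.**  Let `s : ℕ → B` be deterministic (`s i = s j ⟹ s (i+1) = s (j+1)`) and
`p^k`-periodic, with all values in a finite set `A` of elements killed by `p` and `#A < p^k`.  Then
`Σ_{i<p^k} s i = 0`.  Proof: by pigeonhole `s` has a period `≤ #A < p^k`; the LEAST period `d₀` then
satisfies `d₀ < p^k` and `d₀ ∣ p^k`, so `d₀ = p^j` with `j < k` — a `p`-POWER — and `s` is
`p^{k−1}`-periodic; hence `Σ_{i<p^k} s i = p • Σ_{i<p^{k−1}} s i = 0`.  (The form in which "the norm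
`Σ_{i<p^k} Fr^{-i}` kills the `p`-torsion singular parts" is used for Kato's Lemma 8.5 (2) on the pin.)
[cite: Kato2004Asterisque, Lemma 8.5 (2) (p. 183)] [cite: Rubin2000, App. B Prop. B.3.3] -/
theorem sum_range_prime_pow_eq_zero_of_periodic {p : ℕ} (hp : p.Prime)
    (hdet : ∀ i j, s i = s j → s (i + 1) = s (j + 1))
    (A : Set B) (hA : A.Finite) (hmem : ∀ i, s i ∈ A) (htors : ∀ b ∈ A, p • b = 0)
    {k : ℕ} (hk : Nat.card A < p ^ k) (hper : ∀ i, s (i + p ^ k) = s i) :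
    ∑ i ∈ range (p ^ k), s i = 0 := by
  classical
  -- a period `≤ #A`
  obtain ⟨d, hdpos, hdle, hd⟩ :=
    exists_period_le_card s hdet A hA hmem (pow_pos hp.pos k) hper
  -- the least period `d₀ ≤ d < p^k` divides `p^k`, hence is `p^j` with `j < k`
  have hex : ∃ e : ℕ, 0 < e ∧ ∀ t, s (t + e) = s t := ⟨d, hdpos, hd⟩
  set d₀ := Nat.find hex with hd₀
  obtain ⟨hd₀pos, hd₀per⟩ : 0 < d₀ ∧ ∀ t, s (t + d₀) = s t := Nat.find_spec hex
  have hd₀le : d₀ ≤ d := Nat.find_min' hex ⟨hdpos, hd⟩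
  have hd₀lt : d₀ < p ^ k := by omega
  have hdvd : d₀ ∣ p ^ k := find_period_dvd s hex hper
  obtain ⟨j, hjk, hj⟩ := (Nat.dvd_prime_pow hp).1 hdvd
  have hjk' : j < k := by
    rcases hjk.lt_or_eq with h | h
    · exact h
    · exact absurd (hj ▸ h ▸ hd₀lt) (lt_irrefl _)
  -- `s` is `p^(k-1)`-periodic
  obtain ⟨k', rfl⟩ : ∃ k', k = k' + 1 := ⟨k - 1, by omega⟩
  have hdvd' : d₀ ∣ p ^ k' := hj ▸ pow_dvd_pow p (by omega)
  obtain ⟨c, hc⟩ := hdvd'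
  have hper' : ∀ i, s (i + p ^ k') = s i := fun i => by
    rw [hc, apply_add_mul_eq_of_periodic s hd₀per]
  -- `Σ_{i<p^k} = p • Σ_{i<p^(k-1)} = 0`
  rw [pow_succ', sum_range_mul_eq_smul_sum_of_periodic s hper' p, smul_sum]
  exact sum_eq_zero fun i _ => htors _ (hmem i)

/-- **The consumer's instance**: values in a finite set `A` of `p`-torsion elements with `#A ≤ p²`
(k6-g3 `natCard_setOf_smul_eq_zero_le_sq`: `#H¹(U, T_pW)[p] ≤ p²` for every `U`), any `k ≥ 3`:
`Σ_{i<p^k} s i = 0`. [cite: Kato2004Asterisque, Lemma 8.5 (2) (p. 183)] -/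
theorem sum_range_prime_pow_eq_zero_of_periodic_of_le_sq {p : ℕ} (hp : p.Prime)
    (hdet : ∀ i j, s i = s j → s (i + 1) = s (j + 1))
    (A : Set B) (hA : A.Finite) (hmem : ∀ i, s i ∈ A) (htors : ∀ b ∈ A, p • b = 0)
    (hcard : Nat.card A ≤ p ^ 2) {k : ℕ} (hk : 3 ≤ k) (hper : ∀ i, s (i + p ^ k) = s i) :
    ∑ i ∈ range (p ^ k), s i = 0 :=
  sum_range_prime_pow_eq_zero_of_periodic s hp hdet A hA hmem htors
    (lt_of_le_of_lt hcard (Nat.pow_lt_pow_right hp.one_lt (by omega))) hper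

end Periodic

end Summit.BirchSwinnertonDyer.BirchSwinnertonDyer.Rank1Residual.UniversalNorms
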